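import Summits.ValiantsHypothesis.ValiantsHypothesis.Theorems.MatrixDescartes.Negative.HexadecadeWTower

/-!
PLACEMENT NOTE. NEGATIVE knowledge in the Literature (τ) currency, homed under `Theorems/MatrixDescartes/Negative/`
(files 3–4, appended to the two-file cut `HexadecadeSector` / `HexadecadeWTower`): the all-level grid-sign theorem of the
W-tower, text VERBATIM from the planner seat val-idea-13 g1's kernel workfile `Cruxes/MatrixDescartes/Lines/hexadecade.lean`
v10 (§ «The Joukowski itinerary», accepted by critic val-idea-crit-4 as the PB3 appendix, NOTE #7a / ruling g12-R161 (c)),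
split at the seam «the error sum is small» for the 400-line rule, with exactly five lint edits (four unused hypothesis binders
`_`-prefixed — arity and order unchanged —, one unused `simp` argument dropped), theorem docstrings added, and this header;
filed by val-idea-crit-4 g1 (filing hand of record for this lineage, g12-R163 (b)).  The crux `MatrixDescartes`
(`stmt-ValiantsHypothesis-18050`) is NOT touched; 0 provers; VP ≠ VNP is not moved; no summit statement is proved here.

# The hexadecadal sector lies INSIDE the `TauRealZeros` barrier (file 3): the Joukowski itinerary, phase A

`namespace WTower` (continued).  With `v_t = Y_t / Z_t` the ratio along the substitution tower read top-down
(`natPair k p₀ = pIt k i k`, largest dilation `16^(2^(k-1))` first), `v_0 = 16^i` and `v_{t+1} = J(v_t / 16^{n_t})`,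
`J(w) = w + 1/w`, `n_t = 2^(k-1-t)`.  The integer («ideal») itinerary `m_0 = i`, `m_{t+1} = |m_t − n_t|` tracks `log₁₆ v_t`
up to a multiplicative error factor `F_t = ∏ (1 + 256^{-m_s})` as long as `m_s ≥ 1` (phase A): `vIt_eq_div`, `sign_iff`
(grid sign ⟺ `v_k` vs `4`), itinerary combinatorics (`mIt_le`, `mIt_mod_two`, `chain`, `mIt_ne_of_small`), and
`phaseA_bounds : 16^{m_t}/F_t ≤ v_t ≤ 16^{m_t}·F_t`.  File 4 (`HexadecadeWTowerAll`) bounds `F_t ≤ 11/10` and finishes.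

[folklore] Chebyshev/Dickson doubling conjugated by the Joukowski map, re-dilated per level; elementary bookkeeping.
-/

set_option linter.dupNamespace false

noncomputable section

namespace Summit.ValiantsHypothesis.ValiantsHypothesis.Theorems.LacunarySymmetroidMatrixDescartes.Hexadecade

open scoped BigOperators

namespace WTower

/-! ### The Joukowski itinerary — `WTowerSigns k` for ALL `k ≥ 1` (v10)

Write `v_t = Y_t / Z_t` for the ratio along the substitution tower read top-down
(`natPair k p₀ = pIt k i k`, largest dilation `16^(2^(k-1))` first).  Then `v_0 = 16^i` and
`v_{t+1} = J(v_t / 16^{n_t})·` with `J(w) = w + 1/w`, `n_t = 2^(k-1-t)`; the sign of `W_k(16^i)` is the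
sign of `v_k − 4`.  The integer ("ideal") itinerary `m_0 = i`, `m_{t+1} = |m_t − n_t|` shadows `v_t`:
PHASE A (`m_1..m_t ≥ 1`): `v_t ∈ 16^{m_t}·[1/F_t, F_t]` with `F_t = ∏ (1 + 16^{-2 m_s}) ≤ 1/(1 − S_t)` and
`S_t = ∑ 16^{-2 m_s} ≤ 1/50` — because SMALL times (`4 m_s < n_{s-1}`) carry pairwise DISTINCT values
(chain lemma `m_{s+r} = n_{s+r-1} − m_s`), and big times have `m_s ≥ k − 1 − s`; both sums are then
injective geometric sums `≤ 1/255` (+ `2/256` for the last two levels).  PHASE B (first `T` with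
`m_T = n_T`): `v_{T+1} = J(w)`, `w ∈ [1/F, F]`, so `v_{T+1} ∈ [2, 2.2]`.  PHASE C (after B):
`v_t ∈ [16^{n_{t-1}}/2.2, 16^{n_{t-1}}/2 + 2.3·16^{-n_{t-1}}]` is self-reproducing.  Parity
(`m_t ≡ i (mod 2)` for `t ≤ k−1`, `m_{k-1} ≤ 2`, `n_{k-1} = 1`) decides which phase is live at level `k`:
`i` odd ⇒ B at the last level ⇒ `v_k ≤ 2.2 < 4`; `i` even ⇒ A through `k` (`v_k ≥ 16/1.1`) or C
(`v_k ≥ 16/2.2`) ⇒ `v_k > 4`. -/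

section Itinerary
variable (k i : ℕ)

/-- scale exponent at level `t`: `n_t = 2^(k-1-t)` (the level-`t` dilation is `16^(n_t)`). -/
def nS (t : ℕ) : ℕ := 2 ^ (k - 1 - t)

/-- integer (ideal) itinerary: `m_0 = i`, `m_{t+1} = |m_t − n_t|`. -/
def mIt : ℕ → ℕ
  | 0 => i
  | t + 1 => Nat.dist (mIt t) (nS k t)

/-- real ratio itinerary: `v_0 = 16^i`, `v_{t+1} = v_t / 16^{n_t} + 16^{n_t} / v_t`. -/
noncomputable def vIt : ℕ → ℝ
  | 0 => (16:ℝ) ^ i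
  | t + 1 => vIt t / (16:ℝ) ^ nS k t + (16:ℝ) ^ nS k t / vIt t

/-- forward integer pair sequence (`natPair` read top-down). -/
def pIt : ℕ → ℕ × ℕ
  | 0 => (16 ^ i, 1)
  | t + 1 => ((pIt t).1 ^ 2 + 2 ^ 2 ^ (k - 1 - t + 3) * (pIt t).2 ^ 2,
      2 ^ 2 ^ (k - 1 - t + 2) * (pIt t).1 * (pIt t).2)

end Itinerary

variable {k i : ℕ}

/-- Reading the descent top-down: after `t` forward steps `natPair k p₀ = natPair (k - t) (pIt k i t)`. -/
theorem natPair_pIt (t : ℕ) (ht : t ≤ k) :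
    natPair k (16 ^ i, 1) = natPair (k - t) (pIt k i t) := by
  induction t with
  | zero => rfl
  | succ t ih =>
    rw [ih (by omega), show k - t = (k - 1 - t) + 1 by omega, natPair]
    congr 1
    omega

/-- The integer pair descent equals the forward pair sequence at time `k`. -/
theorem natPair_eq_pIt (k i : ℕ) : natPair k (16 ^ i, 1) = pIt k i k := by
  rw [natPair_pIt (k := k) (i := i) k le_rfl, Nat.sub_self]; rfl

/-- `2^(2^(j+2)) = 16^(2^j)`. -/
theorem two_pow_two_pow_add_two (j : ℕ) : (2:ℕ) ^ 2 ^ (j + 2) = 16 ^ 2 ^ j := by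
  rw [show (16:ℕ) = 2 ^ 4 by norm_num, ← pow_mul]; congr 1; rw [pow_add]; norm_num; ring

/-- `2^(2^(j+3)) = (16^(2^j))^2`. -/
theorem two_pow_two_pow_add_three (j : ℕ) : (2:ℕ) ^ 2 ^ (j + 3) = (16 ^ 2 ^ j) ^ 2 := by
  rw [← two_pow_two_pow_add_two, ← pow_mul]; congr 1

/-- Both coordinates of the forward pair sequence are positive. -/
theorem pIt_pos (t : ℕ) : 0 < (pIt k i t).1 ∧ 0 < (pIt k i t).2 := by
  induction t with
  | zero => simp [pIt]
  | succ t ih =>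
    simp only [pIt]
    exact ⟨Nat.add_pos_left (pow_pos ih.1 2) _,
      Nat.mul_pos (Nat.mul_pos (pow_pos (by norm_num) _) ih.1) ih.2⟩

/-- The ratio itinerary is positive. -/
theorem vIt_pos (t : ℕ) : 0 < vIt k i t := by
  induction t with
  | zero => simp [vIt]
  | succ t ih => simp only [vIt]; positivity

/-- The ratio itinerary is the quotient of the forward pair sequence. -/
theorem vIt_eq_div (t : ℕ) : vIt k i t = ((pIt k i t).1 : ℝ) / ((pIt k i t).2 : ℝ) := by
  induction t with
  | zero => simp [vIt, pIt]
  | succ t ih =>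
    obtain ⟨h1, h2⟩ := pIt_pos (k := k) (i := i) t
    simp only [vIt, pIt]
    rw [ih, two_pow_two_pow_add_three, two_pow_two_pow_add_two]
    have hL : (0:ℝ) < (16:ℝ) ^ 2 ^ (k - 1 - t) := by positivity
    have h1' : (0:ℝ) < ((pIt k i t).1 : ℝ) := by exact_mod_cast h1
    have h2' : (0:ℝ) < ((pIt k i t).2 : ℝ) := by exact_mod_cast h2
    push_cast
    simp only [nS]
    field_simp

/-- the sign of `Y − 4Z` at level `k` is the sign of `v_k − 4`. -/
theorem sign_iff (k i : ℕ) :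
    (4 * (natPair k (16 ^ i, 1)).2 < (natPair k (16 ^ i, 1)).1 ↔ 4 < vIt k i k) ∧
    ((natPair k (16 ^ i, 1)).1 < 4 * (natPair k (16 ^ i, 1)).2 ↔ vIt k i k < 4) := by
  rw [natPair_eq_pIt, vIt_eq_div]
  obtain ⟨h1, h2⟩ := pIt_pos (k := k) (i := i) k
  have h2' : (0:ℝ) < ((pIt k i k).2 : ℝ) := by exact_mod_cast h2
  constructor
  · rw [lt_div_iff₀ h2']; exact_mod_cast Iff.rfl
  · rw [div_lt_iff₀ h2']; exact_mod_cast Iff.rfl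

/-! #### combinatorics of the integer itinerary -/

/-- Scale exponents halve from one level to the next: `n_t = 2 n_{t+1}` (for `t + 2 ≤ k`). -/
theorem nS_succ (t : ℕ) (ht : t + 2 ≤ k) : nS k t = 2 * nS k (t + 1) := by
  simp only [nS]; rw [show k - 1 - t = (k - 1 - (t + 1)) + 1 by omega, pow_succ]; ring

/-- The last scale exponent is `1`. -/
theorem nS_last (_hk : 1 ≤ k) : nS k (k - 1) = 1 := by simp [nS]

/-- Scale exponents are at least `1`. -/
theorem nS_pos (t : ℕ) : 1 ≤ nS k t := Nat.one_le_two_pow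

/-- Scale exponents are non-increasing in `t`. -/
theorem nS_anti {t t' : ℕ} (h : t ≤ t') : nS k t' ≤ nS k t := by
  simp only [nS]; exact Nat.pow_le_pow_right (by norm_num) (by omega)

/-- The integer itinerary stays below twice the current scale exponent. -/
theorem mIt_le (hk : 1 ≤ k) (hi : i ≤ 2 ^ k) (t : ℕ) (ht : t + 1 ≤ k) : mIt k i t ≤ 2 * nS k t := by
  induction t with
  | zero => simp only [mIt, nS]; rw [show k = (k - 1 - 0) + 1 by omega, pow_succ] at hi; omega
  | succ t ih =>
    have h := ih (by omega)
    simp only [mIt]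
    have h2 := nS_succ (k := k) t (by omega)
    rw [Nat.dist.eq_def]; omega

/-- The integer itinerary keeps the parity of `i` before the last level. -/
theorem mIt_mod_two (_hk : 1 ≤ k) (t : ℕ) (ht : t + 1 ≤ k) : mIt k i t % 2 = i % 2 := by
  induction t with
  | zero => rfl
  | succ t ih =>
    have h := ih (by omega)
    simp only [mIt]
    have h2 := nS_succ (k := k) t (by omega)
    rw [Nat.dist.eq_def]; omega

/-- the chain after a visit to `μ = m_s`: `m_{s+r} = n_{s+r-1} − μ` as long as `μ ≤ n_{s+r-1}`. -/
theorem chain (s : ℕ) : ∀ r : ℕ, 1 ≤ r → s + r ≤ k → mIt k i s ≤ nS k (s + r - 1) →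
    mIt k i (s + r) = nS k (s + r - 1) - mIt k i s := by
  intro r
  induction r with
  | zero => intro h; omega
  | succ r ih =>
    intro _ hsr hle
    rcases Nat.eq_zero_or_pos r with rfl | hr
    · simp only [add_tsub_cancel_right] at hle ⊢
      show Nat.dist (mIt k i s) (nS k s) = _
      rw [Nat.dist.eq_def]; omega
    · have hle' : mIt k i s ≤ nS k (s + r - 1) := hle.trans (nS_anti (by omega))
      have h := ih hr (by omega) hle'
      have hd : nS k (s + r - 1) = 2 * nS k (s + r) := by
        have := nS_succ (k := k) (s + r - 1) (by omega)
        rwa [show s + r - 1 + 1 = s + r by omega] at this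
      have e1 : s + (r + 1) - 1 = s + r := by omega
      rw [e1] at hle ⊢
      show Nat.dist (mIt k i (s + r)) (nS k (s + r)) = nS k (s + r) - mIt k i s
      rw [h, hd, Nat.dist.eq_def]; omega

/-- a time `s ≥ 1` is SMALL if `4 m_s < n_{s-1}` (i.e. `m_s < n_{s+1}`). -/
def Small (k i s : ℕ) : Prop := 4 * mIt k i s < nS k (s - 1)

/-- values at small times are pairwise distinct (a later small time cannot repeat a value). -/
theorem mIt_ne_of_small {s s' : ℕ} (hss : s < s') (hs' : s' ≤ k) (hsm : Small k i s') :
    mIt k i s ≠ mIt k i s' := by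
  intro heq
  unfold Small at hsm
  have hle : mIt k i s ≤ nS k (s + (s' - s) - 1) := by
    rw [show s + (s' - s) - 1 = s' - 1 by omega]; omega
  have h := chain (k := k) (i := i) s (s' - s) (by omega) (by omega) hle
  rw [show s + (s' - s) = s' by omega] at h
  omega

/-! #### phase A: the multiplicative error factor -/

/-- per-step relative error `16^(−2 m_s)`. -/
noncomputable def xA (k i s : ℕ) : ℝ := 1 / ((16:ℝ) ^ mIt k i s) ^ 2
/-- accumulated error factor `F_t = ∏_{1 ≤ s ≤ t} (1 + 16^(−2 m_s))`. -/
noncomputable def FA (k i t : ℕ) : ℝ := ∏ s ∈ Finset.Icc 1 t, (1 + xA k i s)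
/-- accumulated error sum `S_t = ∑_{1 ≤ s ≤ t} 16^(−2 m_s)`. -/
noncomputable def SA (k i t : ℕ) : ℝ := ∑ s ∈ Finset.Icc 1 t, xA k i s

/-- The phase-A error term is positive. -/
theorem xA_pos (s : ℕ) : 0 < xA k i s := by unfold xA; positivity

/-- The phase-A error term is `(1/256)^(m_s)`. -/
theorem xA_eq (s : ℕ) : xA k i s = (1 / 256 : ℝ) ^ mIt k i s := by
  unfold xA; rw [← pow_mul, one_div_pow, show (256:ℝ) = 16 ^ 2 by norm_num, ← pow_mul, mul_comm]

/-- Recursion for the error product `F_t`. -/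
theorem FA_succ (t : ℕ) : FA k i (t + 1) = FA k i t * (1 + xA k i (t + 1)) := by
  unfold FA; rw [Finset.prod_Icc_succ_top (by omega)]

/-- Recursion for the error sum `S_t`. -/
theorem SA_succ (t : ℕ) : SA k i (t + 1) = SA k i t + xA k i (t + 1) := by
  unfold SA; rw [Finset.sum_Icc_succ_top (by omega)]

/-- The error product is at least `1`. -/
theorem one_le_FA (t : ℕ) : 1 ≤ FA k i t := by
  induction t with
  | zero => simp [FA]
  | succ t ih => rw [FA_succ]; have := xA_pos (k := k) (i := i) (t + 1); nlinarith

/-- The error sum is non-negative. -/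
theorem SA_nonneg (t : ℕ) : 0 ≤ SA k i t :=
  Finset.sum_nonneg fun s _ => (xA_pos (k := k) (i := i) s).le

/-- Product–sum comparison: `F_t ≤ 1 / (1 - S_t)` when `S_t < 1`. -/
theorem FA_le (t : ℕ) (h : SA k i t < 1) : FA k i t ≤ 1 / (1 - SA k i t) := by
  induction t with
  | zero => simp [FA, SA]
  | succ t ih =>
    rw [SA_succ] at h ⊢
    rw [FA_succ]
    have hx := xA_pos (k := k) (i := i) (t + 1)
    have hS := SA_nonneg (k := k) (i := i) t
    have h' : SA k i t < 1 := by linarith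
    have ih' := ih h'
    have hF := one_le_FA (k := k) (i := i) t
    rw [le_div_iff₀ (by linarith)] at ih' ⊢
    have hF0 : (0:ℝ) ≤ FA k i t := by linarith
    nlinarith [mul_nonneg (mul_nonneg hF0 hx.le) hS, mul_nonneg hF0 (mul_nonneg hx.le hx.le)]

/-- the abstract Joukowski step: big term `a ∈ [E/F, E·F]`, small term `0 < b ≤ F/E`. -/
theorem joukowski_bound (E F a b : ℝ) (hE : 0 < E) (hF : 1 ≤ F) (ha : E / F ≤ a) (ha' : a ≤ E * F)
    (hb : 0 < b) (hb' : b ≤ F / E) :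
    E / (F * (1 + 1 / E ^ 2)) ≤ a + b ∧ a + b ≤ E * (F * (1 + 1 / E ^ 2)) := by
  constructor
  · calc E / (F * (1 + 1 / E ^ 2)) ≤ E / F := by
          apply div_le_div_of_nonneg_left hE.le (by positivity)
          have : 0 ≤ F * (1 / E ^ 2) := by positivity
          nlinarith
      _ ≤ a + b := by linarith
  · have : E * (F * (1 + 1 / E ^ 2)) = E * F + F / E := by field_simp
    rw [this]; linarith

/-- **Phase A invariant**: while `m_1, …, m_t ≥ 1`, `v_t ∈ 16^(m_t) · [1/F_t, F_t]`. -/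
theorem phaseA_bounds (t : ℕ) (h : ∀ s, 1 ≤ s → s ≤ t → 1 ≤ mIt k i s) :
    (16:ℝ) ^ mIt k i t / FA k i t ≤ vIt k i t ∧ vIt k i t ≤ (16:ℝ) ^ mIt k i t * FA k i t := by
  induction t with
  | zero => simp [FA, vIt, mIt]
  | succ t ih =>
    have hprev := ih (fun s h1 h2 => h s h1 (by omega))
    have hm1 : 1 ≤ mIt k i (t + 1) := h (t + 1) (by omega) le_rfl
    have hF := one_le_FA (k := k) (i := i) t
    have hv := vIt_pos (k := k) (i := i) t
    rw [FA_succ]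
    set F := FA k i t with hFdef
    set v := vIt k i t with hvdef
    set L : ℝ := (16:ℝ) ^ nS k t with hLdef
    set E : ℝ := (16:ℝ) ^ mIt k i (t + 1) with hEdef
    have hL : 0 < L := by positivity
    have hE : 0 < E := by positivity
    have hx : xA k i (t + 1) = 1 / E ^ 2 := rfl
    have hv' : vIt k i (t + 1) = v / L + L / v := rfl
    rw [hx, hv']
    have hmdef : mIt k i (t + 1) = Nat.dist (mIt k i t) (nS k t) := rfl
    rcases lt_or_gt_of_ne (show mIt k i t ≠ nS k t by
      intro heq; rw [hmdef, heq, Nat.dist_self] at hm1; omega) with hlt | hgt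
    · -- m_t < n_t : the big term is L / v
      have hn : nS k t = mIt k i (t + 1) + mIt k i t := by rw [hmdef, Nat.dist.eq_def]; omega
      set M : ℝ := (16:ℝ) ^ mIt k i t with hMdef
      have hM : 0 < M := by positivity
      have hF0 : 0 < F := by linarith
      have hLEM : L = E * M := by rw [hLdef, hEdef, hMdef, hn, pow_add]
      obtain ⟨h1, h2⟩ := hprev
      have h1' : M ≤ v * F := (div_le_iff₀ hF0).mp h1
      have hb1 : E / F ≤ L / v := by
        rw [hLEM, div_le_div_iff₀ hF0 hv]; nlinarith [mul_le_mul_of_nonneg_left h2 hE.le]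
      have hb2 : L / v ≤ E * F := by
        rw [hLEM, div_le_iff₀ hv]; nlinarith [mul_le_mul_of_nonneg_left h1' hE.le]
      have hs1 : 0 < v / L := by positivity
      have hs2 : v / L ≤ F / E := by
        rw [hLEM, div_le_div_iff₀ (by positivity) hE]; nlinarith [mul_le_mul_of_nonneg_left h2 hE.le]
      have := joukowski_bound E F (L / v) (v / L) hE hF hb1 hb2 hs1 hs2
      have hcomm : v / L + L / v = L / v + v / L := add_comm _ _
      rw [hcomm]; exact this
    · -- n_t < m_t : the big term is v / L
      have hm : mIt k i t = mIt k i (t + 1) + nS k t := by rw [hmdef, Nat.dist.eq_def]; omega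
      have hMEL : (16:ℝ) ^ mIt k i t = E * L := by rw [hm, pow_add]
      rw [hMEL] at hprev
      obtain ⟨h1, h2⟩ := hprev
      have hF0 : 0 < F := by linarith
      have h1' : E * L ≤ v * F := (div_le_iff₀ hF0).mp h1
      have hb1 : E / F ≤ v / L := by rw [div_le_div_iff₀ hF0 hL]; exact h1'
      have hb2 : v / L ≤ E * F := by
        rw [div_le_iff₀ hL]; have : E * L * F = E * F * L := by ring
        linarith
      have hs1 : 0 < L / v := by positivity
      have hs2 : L / v ≤ F / E := by
        rw [div_le_div_iff₀ hv hE]; have : L * E = E * L := mul_comm _ _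
        have : F * v = v * F := mul_comm _ _
        linarith
      exact joukowski_bound E F (v / L) (L / v) hE hF hb1 hb2 hs1 hs2

end WTower

end Summit.ValiantsHypothesis.ValiantsHypothesis.Theorems.LacunarySymmetroidMatrixDescartes.Hexadecade
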